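import Summits.QuantumFields.BalabanUV.Beta.FP.SecondOrderTableEvenPart
import Summits.QuantumFields.BalabanUV.Beta.NVertexParitiesW

/-!
# `BalabanUV.Beta.FP.WoundEvenFamilyParities` — road «FP» for binder row D1, ROUTE T (β1), (R1) of SPEC-54 §9: **THE PARITY ROWS `hWNm ∕ hWNt` OF THE WOUND EVEN
# FAMILY ARE THEOREMS WITH NO DECAY LETTER** — for ANY graded-even lattice kernel `K` (`trK K = sgnK K`, e.g. a copy sum `x z a b ↦ Σ' e, W♮_e x z a b` of even halves
# `W♮ := ½•(W + sgnK (trK W))`), the periodisation `perF M (dper M K)` is graded-symmetric ENTRYWISE (`Ŵ p q = sgnF p.2·sgnF q.2·Ŵ q p`: re-indexing only —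
# `SecondOrderTableEvenPart.dper_trK ∕ dper_sgnK ∕ perF_trK_apply ∕ perF_sgnK_apply`, NO summability), hence ANTI-twin on the (field, multiplier) border and twin on
# the `ff` block; and a kernel with no `μμ` block pointwise has none after periodisation (`tsum_zero`).  §3 instantiates both at the record's WOUND EVEN N-FAMILY
# `x z a b ↦ Σ' e, (WN (Roots.ctr Lc) Pn (n+1) μ y ν (y′ + (Mc B)∘e))♮ x z a b` in the END wrapper's shapes (`fN ∕ hmN`) — the v5 rows `hWNm ∕ hWNt` for `TowerKernelLawNamedC`

WHY (`HOME/b2b-balaban-beta-d1-p3/g43/SPEC-55.md` §4; an2 g67 J-NOTE-7 (R1) «parities termwise»).  v4 fed `TowerKernelLawNamedB` the even half `WN♮` and got `hWNm ∕ hWNt`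
from `SecondOrderTableEvenPart.perF_dper_evenHalf_mm ∕ _antitwin_fμ`, which SPLIT `perF (dper (W + sgnK trK W))` and therefore need `BiLoc W`.  The wound family
`Σ' e, WN♮ μ y ν (y′ + Mc∘e)` is NOT bi-localised (it is periodic in the second source's windings) and its periodisation converges only under the separation letter
(J-NOTE-8) — but its PARITIES need none of that: graded-evenness `trK K = sgnK K` is a pointwise identity, it passes through `Σ'` (`tsum_mul_left`, definitional
re-indexing), `dper` (re-indexing, `tsum_mul_left`) and `perF` (`perF_transpose` at the `Mℤ`-invariant `dper M K`, `perF_scaleK_apply`); the `μμ` block of `WN` vanishes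
POINTWISE (an2 `NVertexParitiesW.WN_inr_inr`), termwise under `Σ'`, and `perF ∘ dper` of a kernel with zero `μμ` block has zero `μμ` entries by `tsum_zero`.
WHAT ([folklore]; no `def`, no `def … : Prop`, nothing cited, 0 sorry; generic `d` in §1–§2):
§1 `parityEven_tsum` (a pointwise `Σ'` of graded-even kernels is graded-even), `parityEven_dper`, **`perF_dper_apply_of_parityEven`** (`Ŵ p q = sgnF p.2·sgnF q.2·Ŵ q p`),
`perF_dper_antitwin_fμ_of_parityEven` (the wrapper's `hW_Xt` shape along a multiplier-valued slot map), `perF_dper_symm_ff_of_parityEven`;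
§2 `inr_inr_tsum_eq_zero`, `inr_inr_evenHalf_eq_zero`, **`perF_dper_apply_eq_zero_of_inr_inr`** (the wrapper's `hW_Xm` shape);
§3 at the record (`d = 3`): `WN_evenHalf_wound_parityEven`, `WN_evenHalf_wound_inr_inr`, **`hWNm_rows_wound`**, **`hWNt_rows_wound`** — v4's `TowerNParityRowsEven.hWNm_rows_even ∕
hWNt_rows_even` with `WN♮ μ y ν y′` replaced by the wound even family at box `B`, SAME binders `Mc Pn fN hmN`.
WHAT THIS IS NOT: not the winding letter `hWNw` (an2's (ii) + separation letter), not `hWN` (the `d = 0` member's `BiLoc`, v4's `exists_NN_rows_even` VERBATIM), not the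
content rows; nothing of Bałaban's asserted; 0 estimates; 0∕4 row-D1 binders (hW, hR, D1Tel, D1Rep); NOT (C1), NOT (T-ID), NOT D1, NOT BetaPertH, NOT continuum, NOT Clay.

HONEST DEPENDENCY (page 1, mandatory): continuum YM on T⁴ ⇐ BetaPertH ∧ nine spine estimates (0/9 proved); BetaPertH ⇐ (D1) ∧ (D4) ∧ CAP+tail;
G-an2-4 gates asym, D1 and NE2/3/4.  HONEST FRAMING (cell contract, verbatim): «discharging `BetaPertH` makes Bałaban's UV stability UNCONDITIONAL —
a real constructive-QFT result; it is NOT the continuum limit and NOT the Clay problem.»  ABSOLUTE RULE (cell charter, verbatim): «No internally-minted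
statement may enter as a cited fact. Every hypothesis is either kernel-proved in this package or a verbatim quotation of a PUBLISHED theorem with page
reference. The manuscript(s) under audit are NOT citable for their own disputed steps — they are the thing under adjudication; programme-internal
(2001/route/tribunal) claims are never citable.»  Road «FP» OWNER, b2b-balaban-beta-d1-p3 gen 43, 2026-08-27.  No existing file touched.
-/

noncomputable section

open scoped BigOperators

namespace Summit.QuantumFields.BalabanUV.Beta.FP.WoundEvenFamilyParities

open Literature.MathematicalPhysics.QuantumFieldTheory.Balaban1983to89
open Literature.MathematicalPhysics.QuantumFieldTheory.Balaban1983to89.Beta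
open B4TorusKernel.MultiPeriod (translate)
open B5Prop11Plancherel (fine)
open B6Lemma24Torus (pbox)
open ExpKernelCalculus (MKer)
open OneStepResolventKernel (Fib)
open AffineAveraging (Site)
open Summit.QuantumFields.BalabanUV.Beta.TameKernelCalculus (trK trK_apply)
open Summit.QuantumFields.BalabanUV.Beta.BorderedHessian (sgnF sgnF_inl sgnF_inr sgnF_mul_self sgnK sgnK_apply)
open Summit.QuantumFields.BalabanUV.Beta.GAN24.SecondOrderReadersParity (parityEven_evenHalf)
open Summit.QuantumFields.BalabanUV.Beta.FP.KernelPeriodisationFib (Idx perF perF_apply perZ_apply)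
open Summit.QuantumFields.BalabanUV.Beta.FP.KernelPeriodisationFibLoc (dper dper_apply dper_translate)
open Summit.QuantumFields.BalabanUV.Beta.FP.SecondOrderTableEvenPart (dper_trK dper_sgnK perF_trK_apply perF_sgnK_apply)
open Summit.QuantumFields.BalabanUV.Beta.FP.TorusCompositeObjects (towerTorus)
open Summit.QuantumFields.BalabanUV.Beta.CompositeOneShotJetData (Roots Pins WN)
open Summit.QuantumFields.BalabanUV.Beta.NVertexParitiesW (WN_inr_inr)

variable {d : ℕ}

/-! ## §1 Graded-even kernels: through `Σ'`, through `dper`, and on the torus (re-indexing only) -/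

section Even

/-- [folklore] **a pointwise `Σ'` of graded-even kernels is graded-even** (`trK (K e) = sgnK (K e)` for every `e` ⟹ the same for `x z a b ↦ Σ' e, K e x z a b`;
`tsum_mul_left`, no summability). -/
theorem parityEven_tsum {ι : Type*} (K : ι → MKer (d + 1) (Fib d)) (hK : ∀ e, trK (K e) = sgnK (K e)) :
    trK (fun x z a b => ∑' e, K e x z a b) = sgnK (fun x z a b => ∑' e, K e x z a b) := by
  funext x z a b
  rw [trK_apply, sgnK_apply, ← tsum_mul_left]
  refine tsum_congr fun e => ?_
  have h := congrFun (congrFun (congrFun (congrFun (hK e) x) z) a) b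
  rw [trK_apply, sgnK_apply] at h
  exact h

/-- [folklore] **`dper` preserves graded-evenness** (`dper_trK`, `dper_sgnK`: re-indexing and `tsum_mul_left`). -/
theorem parityEven_dper (M : Fin (d + 1) → ℕ) {K : MKer (d + 1) (Fib d)} (hK : trK K = sgnK K) : trK (dper M K) = sgnK (dper M K) := by
  rw [← dper_trK, hK, dper_sgnK]

variable (M : Fin (d + 1) → ℕ)

/-- [folklore] **`perF_dper_apply_of_parityEven` — THE TORUS FACE OF GRADED-EVENNESS, ENTRYWISE, NO DECAY LETTER**: for `trK K = sgnK K`,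
`perF M (dper M K) p q = sgnF p.2 · sgnF q.2 · perF M (dper M K) q p` (`perF_trK_apply` at the `Mℤ`-invariant `dper M K` + `perF_sgnK_apply`). -/
theorem perF_dper_apply_of_parityEven {K : MKer (d + 1) (Fib d)} (hK : trK K = sgnK K) (p q : Idx M (Fib d)) :
    perF M (dper M K) p q = sgnF p.2 * sgnF q.2 * perF M (dper M K) q p := by
  have h1 : perF M (trK (dper M K)) p q = perF M (dper M K) q p := perF_trK_apply M (fun m x y a b => dper_translate M K m x y a b) p q
  rw [parityEven_dper M hK, perF_sgnK_apply] at h1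
  have hs : sgnF p.2 * sgnF q.2 * (sgnF p.2 * sgnF q.2 * perF M (dper M K) p q) = perF M (dper M K) p q := by
    have hp := sgnF_mul_self (d := d) p.2
    have hq := sgnF_mul_self (d := d) q.2
    calc sgnF p.2 * sgnF q.2 * (sgnF p.2 * sgnF q.2 * perF M (dper M K) p q)
        = (sgnF p.2 * sgnF p.2) * (sgnF q.2 * sgnF q.2) * perF M (dper M K) p q := by ring
      _ = perF M (dper M K) p q := by rw [hp, hq, one_mul, one_mul]
  rw [← hs, h1]

variable {μ : Type*} (fμ : μ → Idx M (Fib d))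

/-- [folklore] **`perF_dper_antitwin_fμ_of_parityEven` — THE WRAPPER's ROW `hW_Xt` FOR ANY GRADED-EVEN KERNEL**: along a multiplier-valued slot map,
`Ŵ (b̃, fμ a) = −Ŵ (fμ a, b̃)`. -/
theorem perF_dper_antitwin_fμ_of_parityEven (hμ : ∀ a : μ, ∃ m : Fin (d + 1), (fμ a).2 = Sum.inr m)
    {K : MKer (d + 1) (Fib d)} (hK : trK K = sgnK K) (b : ↥(pbox M) × Fin (d + 1)) (a : μ) :
    perF M (dper M K) (b.1, Sum.inl b.2) (fμ a) = -perF M (dper M K) (fμ a) (b.1, Sum.inl b.2) := by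
  obtain ⟨m, hm⟩ := hμ a
  rw [perF_dper_apply_of_parityEven M hK (b.1, Sum.inl b.2) (fμ a), hm, sgnF_inl, sgnF_inr]
  ring

/-- [folklore] the `ff` block of the periodisation of a graded-even kernel is symmetric. -/
theorem perF_dper_symm_ff_of_parityEven {K : MKer (d + 1) (Fib d)} (hK : trK K = sgnK K) (b b' : ↥(pbox M) × Fin (d + 1)) :
    perF M (dper M K) (b.1, Sum.inl b.2) (b'.1, Sum.inl b'.2) = perF M (dper M K) (b'.1, Sum.inl b'.2) (b.1, Sum.inl b.2) := by
  rw [perF_dper_apply_of_parityEven M hK (b.1, Sum.inl b.2) (b'.1, Sum.inl b'.2), sgnF_inl, sgnF_inl, one_mul, one_mul]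

end Even

/-! ## §2 Kernels with no `μμ` block: through `Σ'`, through the even half, and on the torus -/

section MM

/-- [folklore] a pointwise `Σ'` of kernels with zero `μμ` block has zero `μμ` block (`tsum_zero`). -/
theorem inr_inr_tsum_eq_zero {ι : Type*} (K : ι → MKer (d + 1) (Fib d)) (hK : ∀ e x z (m m' : Fin (d + 1)), K e x z (Sum.inr m) (Sum.inr m') = 0)
    (x z : Fin (d + 1) → ℤ) (m m' : Fin (d + 1)) : (∑' e, K e x z (Sum.inr m) (Sum.inr m')) = 0 := by
  simp only [hK, tsum_zero]

/-- [folklore] the even half of a kernel with zero `μμ` block has zero `μμ` block (pointwise). -/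
theorem inr_inr_evenHalf_eq_zero {W : MKer (d + 1) (Fib d)} (hW : ∀ x z (m m' : Fin (d + 1)), W x z (Sum.inr m) (Sum.inr m') = 0)
    (x z : Fin (d + 1) → ℤ) (m m' : Fin (d + 1)) : ((1 / 2 : ℝ) • (W + sgnK (trK W))) x z (Sum.inr m) (Sum.inr m') = 0 := by
  simp only [Pi.smul_apply, Pi.add_apply, smul_eq_mul, sgnK_apply, trK_apply, hW, mul_zero, add_zero]

variable (M : Fin (d + 1) → ℕ) {μ : Type*} (fμ : μ → Idx M (Fib d))

/-- [folklore] **`perF_dper_apply_eq_zero_of_inr_inr` — THE WRAPPER's ROW `hW_Xm` FOR ANY KERNEL WITH ZERO `μμ` BLOCK, NO DECAY LETTER**: along a multiplier-valued slot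
map, `Ŵ (fμ a) (fμ a′) = 0` (`perF_apply ∕ perZ_apply ∕ dper_apply` + `tsum_zero`). -/
theorem perF_dper_apply_eq_zero_of_inr_inr (hμ : ∀ a : μ, ∃ m : Fin (d + 1), (fμ a).2 = Sum.inr m)
    {K : MKer (d + 1) (Fib d)} (hK : ∀ x z (m m' : Fin (d + 1)), K x z (Sum.inr m) (Sum.inr m') = 0) (a a' : μ) :
    perF M (dper M K) (fμ a) (fμ a') = 0 := by
  obtain ⟨m, hm⟩ := hμ a
  obtain ⟨m', hm'⟩ := hμ a'
  rw [perF_apply, perZ_apply, hm, hm']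
  simp only [dper_apply, hK, tsum_zero]

end MM

/-! ## §3 At the record: the WOUND EVEN N-family's rows `hWNm ∕ hWNt` in the END wrapper's shapes -/

section Record

variable {Lc : ℕ} [NeZero Lc] (Mc : ℕ → (Fin (3 + 1) → ℕ)) (Pn : Pins)
  (fN : ∀ n : ℕ, ∀ B : ℕ, (↥(pbox (Mc B)) × Fin (3 + 1)) → Idx (towerTorus Lc (fine Lc (Mc B)) (n + 1)) (Fib 3))
  (hmN : ∀ n : ℕ, ∀ B : ℕ, ∀ a : (↥(pbox (Mc B)) × Fin (3 + 1)), ∃ m : Fin (3 + 1), ((fN n) B a).2 = Sum.inr m)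

/-- [folklore] the wound even N-family `x z a b ↦ Σ' e, (WN … μ y ν (y′ + Mc∘e))♮ x z a b` is graded-even (§1 `parityEven_tsum` over GAN24 `parityEven_evenHalf`). -/
theorem WN_evenHalf_wound_parityEven (n : ℕ) (μ : Fin (3 + 1)) (y : Site (3 + 1)) (ν : Fin (3 + 1)) (y' : Site (3 + 1)) (B : ℕ) :
    trK (fun x z a b => ∑' e : Site (3 + 1), ((1 / 2 : ℝ) • (WN (Roots.ctr Lc) Pn (n + 1) μ y ν (translate (Mc B) y' e)
          + sgnK (trK (WN (Roots.ctr Lc) Pn (n + 1) μ y ν (translate (Mc B) y' e))))) x z a b)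
      = sgnK (fun x z a b => ∑' e : Site (3 + 1), ((1 / 2 : ℝ) • (WN (Roots.ctr Lc) Pn (n + 1) μ y ν (translate (Mc B) y' e)
          + sgnK (trK (WN (Roots.ctr Lc) Pn (n + 1) μ y ν (translate (Mc B) y' e))))) x z a b) :=
  parityEven_tsum _ fun _ => parityEven_evenHalf _

/-- [folklore] … and has zero `μμ` block pointwise (an2 `NVertexParitiesW.WN_inr_inr` termwise). -/
theorem WN_evenHalf_wound_inr_inr (n : ℕ) (μ : Fin (3 + 1)) (y : Site (3 + 1)) (ν : Fin (3 + 1)) (y' : Site (3 + 1)) (B : ℕ)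
    (x z : Site (3 + 1)) (m m' : Fin (3 + 1)) :
    (fun x z a b => ∑' e : Site (3 + 1), ((1 / 2 : ℝ) • (WN (Roots.ctr Lc) Pn (n + 1) μ y ν (translate (Mc B) y' e)
          + sgnK (trK (WN (Roots.ctr Lc) Pn (n + 1) μ y ν (translate (Mc B) y' e))))) x z a b) x z (Sum.inr m) (Sum.inr m') = 0 :=
  inr_inr_tsum_eq_zero _ (fun e x' z' m₁ m₂ => inr_inr_evenHalf_eq_zero
      (fun x'' z'' m₃ m₄ => WN_inr_inr (Roots.ctr Lc) Pn (n + 1) μ y ν (translate (Mc B) y' e) x'' z'' m₃ m₄) x' z' m₁ m₂)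
    x z m m'

include hmN in
/-- [folklore] **`hWNm_rows_wound` — THE v5 ROW `hWNm` FOR THE WOUND EVEN N-FAMILY, A THEOREM**: on two N-leg indices the periodised wound even family vanishes, at every
depth, label pair and box (§2, no decay letter). -/
theorem hWNm_rows_wound :
    ∀ (n : ℕ) (μ : Fin (3 + 1)) (y : Fin (3 + 1) → ℤ) (ν : Fin (3 + 1)) (y' : Fin (3 + 1) → ℤ), ∀ B : ℕ, ∀ a a' : (↥(pbox (Mc B)) × Fin (3 + 1)),
    (perF (towerTorus Lc (fine Lc (Mc B)) (n + 1)) (dper (towerTorus Lc (fine Lc (Mc B)) (n + 1))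
        (fun x z a b => ∑' e : Site (3 + 1), ((1 / 2 : ℝ) • (WN (Roots.ctr Lc) Pn (n + 1) μ y ν (translate (Mc B) y' e)
          + sgnK (trK (WN (Roots.ctr Lc) Pn (n + 1) μ y ν (translate (Mc B) y' e))))) x z a b))) (((fN n) B) a) (((fN n) B) a') = 0 :=
  fun n μ y ν y' B a a' =>
    perF_dper_apply_eq_zero_of_inr_inr _ ((fN n) B) ((hmN n) B) (fun x z m m' => WN_evenHalf_wound_inr_inr Mc Pn n μ y ν y' B x z m m') a a'

include hmN in
/-- [folklore] **`hWNt_rows_wound` — THE v5 ROW `hWNt` FOR THE WOUND EVEN N-FAMILY, A THEOREM**: the ANTI-twin (field, multiplier) border of the periodised wound even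
family, at every depth, label pair and box (§1, no decay letter). -/
theorem hWNt_rows_wound :
    ∀ (n : ℕ) (μ : Fin (3 + 1)) (y : Fin (3 + 1) → ℤ) (ν : Fin (3 + 1)) (y' : Fin (3 + 1) → ℤ), ∀ B : ℕ,
    ∀ (b : (↥(pbox (towerTorus Lc (fine Lc (Mc B)) (n + 1))) × Fin (3 + 1))) (a : (↥(pbox (Mc B)) × Fin (3 + 1))),
    (perF (towerTorus Lc (fine Lc (Mc B)) (n + 1)) (dper (towerTorus Lc (fine Lc (Mc B)) (n + 1))
        (fun x z a b => ∑' e : Site (3 + 1), ((1 / 2 : ℝ) • (WN (Roots.ctr Lc) Pn (n + 1) μ y ν (translate (Mc B) y' e)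
          + sgnK (trK (WN (Roots.ctr Lc) Pn (n + 1) μ y ν (translate (Mc B) y' e))))) x z a b))) (b.1, Sum.inl b.2) (((fN n) B) a)
      = -(perF (towerTorus Lc (fine Lc (Mc B)) (n + 1)) (dper (towerTorus Lc (fine Lc (Mc B)) (n + 1))
        (fun x z a b => ∑' e : Site (3 + 1), ((1 / 2 : ℝ) • (WN (Roots.ctr Lc) Pn (n + 1) μ y ν (translate (Mc B) y' e)
          + sgnK (trK (WN (Roots.ctr Lc) Pn (n + 1) μ y ν (translate (Mc B) y' e))))) x z a b))) (((fN n) B) a) (b.1, Sum.inl b.2) :=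
  fun n μ y ν y' B b a =>
    perF_dper_antitwin_fμ_of_parityEven _ ((fN n) B) ((hmN n) B) (WN_evenHalf_wound_parityEven Mc Pn n μ y ν y' B) b a

end Record

end Summit.QuantumFields.BalabanUV.Beta.FP.WoundEvenFamilyParities

end
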